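import Literature.AlgebraicGeometry.Resolution.WeightedCentreOrderFiltration
import HarnessLib

/-!
# Reduction of the order filtration modulo an ideal: the truncated group `𝔄̄`
# (engine 1's `W(f)` toy model, T101/T107 — an instrument, NOT a resolution theorem)

CARVER-NOTES-eng1-g44 §1, the "one addition wanted for T107": the abstract order filtration `OrderFiltration.level r a` (automorphisms
`A` of a commutative ring `S` fixing `r` with `A ≡ id (mod r^a)`) instantiated for the TRUNCATED ring `S ⧸ I` (toy model: `I = (σ^p)`,
`S ⧸ I = R[ε]`, `R = k[σ]/(σ^p)`), together with the reduction homomorphism `red : 𝔄 →* 𝔄̄`.  Hypothesis-free bookkeeping: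

* `idealStab I` — the subgroup of ring automorphisms `A` with `A(I) = I`; automorphisms fixing `r` (or rescaling it by a unit, as the
  torus `s_μ : σ ↦ μσ` does) stabilise `(r^n)` (`mem_idealStab_span_pow`, `mem_idealStab_span_pow_of_apply_eq_mul`);
* `reduce I : idealStab I →* (S ⧸ I ≃+* S ⧸ I)` — `A ↦ Ā` (`Ideal.quotientEquiv`), `reduce_mk`; a group homomorphism, hence compatible
  with conjugation (`reduce_conj` — "`red` is `Q`-equivariant" once the torus lies in `idealStab I`);
  `reduce A = reduce B ↔ A ≡ B (mod I)` (`reduce_eq_iff`);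
* levels descend: `A ∈ level r a ⇒ Ā ∈ level r̄ a` (`reduce_mem_level`), and the truncated filtration STOPS: `r^a = 0 ⇒ level r a = ⊥`
  (`level_eq_bot_of_pow_eq_zero`), so `level r̄ n = ⊥` in `S ⧸ (r^n)` (`level_mk_span_pow_eq_bot`) and `Ā = 1` for `A ∈ level r n`
  (`reduce_eq_one_of_mem_level`);
* `truncEquiv I Φ Ψ …` — ring ENDOmorphisms `Φ, Ψ` preserving `I` and inverse to each other modulo `I` induce an automorphism `Φ̄`
  of `S ⧸ I` (the truncated flow `Ψ_𝔇(σ)` / `Ψ_𝔇(−σ)` of `WeightedCentreTruncatedFlow` modulo `σ^p`), `Φ̄ ∈ level r̄ a` when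
  `Φ ≡ id (mod r^a)` (`truncEquiv_mem_level`), and `red A = Φ̄ ↔ A ≡ Φ (mod I)` (`reduce_eq_truncEquiv_iff` — T107 `r = 1`).

Framing: instruments for engine 1's `W(f)` toy model (cell `pub-rosobs`; AI-written Lean, AI review weaker than expert review) — NOT
statements about the invariant of [AbramovichTemkinWlodarczyk2024], NOT resolution theorems; [Lang2002, Ch. II §1, Ch. I §3] is cited for
the elementary algebra.
-/

namespace Literature.AlgebraicGeometry.Resolution.WeightedBlowup.OrderFiltration

variable {S : Type*} [CommRing S]

/-! ## The truncated filtration stops -/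

/-- `r ^ a = 0 ⇒ level r a = ⊥`: modulo `r^a` only the identity is `≡ id (mod r^a)` (bookkeeping; `𝔄̄_p = ⊥` of CARVER-NOTES-eng1-g44 §1).
[cite: Lang2002, Ch. II §1] -/
theorem level_eq_bot_of_pow_eq_zero {r : S} {a : ℕ} (h : r ^ a = 0) : level r a = ⊥ :=
  (Subgroup.eq_bot_iff_forall _).mpr fun A hA => RingEquiv.ext fun y => by
    obtain ⟨z, hz⟩ := hA.2 y
    rw [hz, h, zero_mul, add_zero]
    rfl

/-! ## The stabiliser of an ideal and the reduction homomorphism -/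

/-- The ring automorphisms `A` with `A(I) = I`. [cite: Lang2002, Ch. II §1] -/
def idealStab (I : Ideal S) : Subgroup (S ≃+* S) where
  carrier := {A | I.map (A : S →+* S) = I}
  mul_mem' {A B} hA hB := by
    show I.map ((A * B : S ≃+* S) : S →+* S) = I
    rw [show ((A * B : S ≃+* S) : S →+* S) = (A : S →+* S).comp (B : S →+* S) from RingHom.ext fun _ => rfl, ← Ideal.map_map,
      hB, hA]
  one_mem' := by
    show I.map ((1 : S ≃+* S) : S →+* S) = I
    rw [show ((1 : S ≃+* S) : S →+* S) = RingHom.id S from RingHom.ext fun _ => rfl, Ideal.map_id]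
  inv_mem' {A} hA := by
    show I.map ((A⁻¹ : S ≃+* S) : S →+* S) = I
    conv_lhs => rw [← hA]
    rw [Ideal.map_map, show ((A⁻¹ : S ≃+* S) : S →+* S).comp (A : S →+* S) = RingHom.id S from
      RingHom.ext fun x => A.symm_apply_apply x, Ideal.map_id]

/-- Membership in `idealStab`. [cite: Lang2002, Ch. II §1] -/
theorem mem_idealStab {I : Ideal S} {A : S ≃+* S} : A ∈ idealStab I ↔ I.map (A : S →+* S) = I := Iff.rfl

/-- An automorphism rescaling `r` by a unit stabilises `(r^n)` (the torus `σ ↦ μσ` of the toy model). [cite: Lang2002, Ch. II §1] -/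
theorem mem_idealStab_span_pow_of_apply_eq_mul {r c : S} (hc : IsUnit c) {A : S ≃+* S} (hA : A r = c * r) (n : ℕ) :
    A ∈ idealStab (Ideal.span {r ^ n}) := by
  rw [mem_idealStab, Ideal.map_span, Set.image_singleton, RingHom.coe_coe, map_pow, hA, mul_pow]
  exact Ideal.span_singleton_mul_left_unit (hc.pow n) _

/-- An automorphism fixing `r` stabilises `(r^n)`. [cite: Lang2002, Ch. II §1] -/
theorem mem_idealStab_span_pow {r : S} {A : S ≃+* S} (hA : A r = r) (n : ℕ) : A ∈ idealStab (Ideal.span {r ^ n}) :=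
  mem_idealStab_span_pow_of_apply_eq_mul isUnit_one (by rw [one_mul, hA]) n

/-- Every level of the order filtration stabilises `(r^n)`. [cite: Lang2002, Ch. II §1] -/
theorem level_le_idealStab (r : S) (a n : ℕ) : level r a ≤ idealStab (Ideal.span {r ^ n}) := fun _ hA =>
  mem_idealStab_span_pow hA.1 n

/-- **The reduction homomorphism** `red : A ↦ Ā` on `S ⧸ I` (CARVER-NOTES-eng1-g44 §1: `red : 𝔄 →* 𝔄̄`). [cite: Lang2002, Ch. II §1] -/
def reduce (I : Ideal S) : idealStab I →* (S ⧸ I ≃+* S ⧸ I) where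
  toFun A := Ideal.quotientEquiv I I (A : S ≃+* S) (mem_idealStab.mp A.2).symm
  map_one' := RingEquiv.ext fun x => by
    obtain ⟨y, rfl⟩ := Ideal.Quotient.mk_surjective x
    rw [Ideal.quotientEquiv_mk]
    rfl
  map_mul' A B := RingEquiv.ext fun x => by
    obtain ⟨y, rfl⟩ := Ideal.Quotient.mk_surjective x
    rw [Ideal.quotientEquiv_mk, RingAut.mul_apply, Ideal.quotientEquiv_mk, Ideal.quotientEquiv_mk]
    rfl

/-- `red A` on a class (bookkeeping). [cite: Lang2002, Ch. II §1] -/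
@[simp] theorem reduce_mk {I : Ideal S} (A : idealStab I) (y : S) :
    reduce I A (Ideal.Quotient.mk I y) = Ideal.Quotient.mk I ((A : S ≃+* S) y) :=
  Ideal.quotientEquiv_mk I I (A : S ≃+* S) (mem_idealStab.mp A.2).symm y

/-- `red` is compatible with conjugation (it is a group homomorphism): "`red` is `Q`-equivariant" once the torus lies in `idealStab I`
(bookkeeping). [cite: Lang2002, Ch. I §3] -/
theorem reduce_conj {I : Ideal S} (g A : idealStab I) : reduce I (g * A * g⁻¹) = reduce I g * reduce I A * (reduce I g)⁻¹ := by
  rw [map_mul, map_mul, map_inv]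

/-- `red A = red B ↔ A ≡ B (mod I)` pointwise (bookkeeping; "`X′ ≡ Ψ_𝔇(σ) mod σ^p`" is an equality in `𝔄̄`).
[cite: Lang2002, Ch. II §1] -/
theorem reduce_eq_iff {I : Ideal S} {A B : idealStab I} :
    reduce I A = reduce I B ↔ ∀ y, (A : S ≃+* S) y - (B : S ≃+* S) y ∈ I := by
  refine ⟨fun h y => Ideal.Quotient.eq.mp (by rw [← reduce_mk, ← reduce_mk, h]), fun h => RingEquiv.ext fun x => ?_⟩
  obtain ⟨y, rfl⟩ := Ideal.Quotient.mk_surjective x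
  rw [reduce_mk, reduce_mk]
  exact Ideal.Quotient.eq.mpr (h y)

/-! ## Levels descend, and the truncated filtration stops at the exponent -/

/-- `A ∈ level r a ⇒ red A ∈ level r̄ a` (bookkeeping; (F2)–(F5) then hold verbatim in `𝔄̄`). [cite: Lang2002, Ch. II §1] -/
theorem reduce_mem_level {I : Ideal S} {r : S} {a : ℕ} {A : idealStab I} (hA : (A : S ≃+* S) ∈ level r a) :
    reduce I A ∈ level (Ideal.Quotient.mk I r) a := by
  refine ⟨by rw [reduce_mk, hA.1], fun x => ?_⟩
  obtain ⟨y, rfl⟩ := Ideal.Quotient.mk_surjective x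
  obtain ⟨z, hz⟩ := hA.2 y
  exact ⟨Ideal.Quotient.mk I z, by rw [reduce_mk, hz, map_add, map_mul, map_pow]⟩

/-- In `S ⧸ (r^n)` the filtration stops at `n`: `level r̄ n = ⊥` (`𝔄̄_p = ⊥`). [cite: Lang2002, Ch. II §1] -/
theorem level_mk_span_pow_eq_bot (r : S) (n : ℕ) : level (Ideal.Quotient.mk (Ideal.span {r ^ n}) r) n = ⊥ :=
  level_eq_bot_of_pow_eq_zero (by rw [← map_pow, Ideal.Quotient.eq_zero_iff_mem]; exact Ideal.subset_span rfl)

/-- Hence `red A = 1` for `A ∈ level r n`, reducing modulo `(r^n)` (bookkeeping). [cite: Lang2002, Ch. II §1] -/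
theorem reduce_eq_one_of_mem_level {r : S} {n : ℕ} {A : idealStab (Ideal.span {r ^ n})} (hA : (A : S ≃+* S) ∈ level r n) :
    reduce (Ideal.span {r ^ n}) A = 1 := by
  have h := reduce_mem_level hA
  rwa [level_mk_span_pow_eq_bot, Subgroup.mem_bot] at h

/-- … and more generally `red A = red B` modulo `(r^n)` whenever `A ≡ B (mod r^n)` slot-wise, e.g. `A⁻¹B ∈ level r n` (bookkeeping).
[cite: Lang2002, Ch. II §1] -/
theorem reduce_eq_of_inv_mul_mem_level {r : S} {n : ℕ} {A B : idealStab (Ideal.span {r ^ n})} (h : (A⁻¹ * B : S ≃+* S) ∈ level r n) :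
    reduce (Ideal.span {r ^ n}) A = reduce (Ideal.span {r ^ n}) B := by
  have h1 : reduce (Ideal.span {r ^ n}) (A⁻¹ * B) = 1 := reduce_eq_one_of_mem_level h
  rwa [map_mul, map_inv, inv_mul_eq_one] at h1

/-! ## Endomorphisms invertible modulo `I` give elements of the truncated group -/

/-- An endomorphism fixing `r` maps `(r^n)` into itself (bookkeeping; the descent condition of `Ideal.quotientMap`).
[cite: Lang2002, Ch. II §1] -/
theorem span_pow_le_comap {r : S} {Φ : S →+* S} (hΦ : Φ r = r) (n : ℕ) : Ideal.span {r ^ n} ≤ (Ideal.span {r ^ n}).comap Φ :=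
  Ideal.span_le.mpr (Set.singleton_subset_iff.mpr (by
    rw [SetLike.mem_coe, Ideal.mem_comap, map_pow, hΦ]
    exact Ideal.mem_span_singleton_self _))

/-- **The truncated automorphism of an endomorphism invertible modulo `I`**: ring endomorphisms `Φ, Ψ` of `S` preserving `I` with
`ΨΦ ≡ id ≡ ΦΨ (mod I)` induce the AUTOMORPHISM `Φ̄` of `S ⧸ I` (toy model: the truncated flow `Ψ_𝔇(σ)` and `Ψ_𝔇(−σ)` of
`WeightedCentreTruncatedFlow`, inverse to each other modulo `σ^p`, give `Ψ̄_𝔇(σ̄) ∈ 𝔄̄` — CARVER-NOTES-eng1-g44 §1, T107 case `r = 1`).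
[cite: Lang2002, Ch. II §1] -/
noncomputable def truncEquiv (I : Ideal S) (Φ Ψ : S →+* S) (hΦ : I ≤ I.comap Φ) (hΨ : I ≤ I.comap Ψ)
    (h₁ : ∀ y, Ψ (Φ y) - y ∈ I) (h₂ : ∀ y, Φ (Ψ y) - y ∈ I) : S ⧸ I ≃+* S ⧸ I :=
  RingEquiv.ofBijective (Ideal.quotientMap I Φ hΦ)
    ⟨Function.LeftInverse.injective (g := Ideal.quotientMap I Ψ hΨ) fun x => by
        obtain ⟨y, rfl⟩ := Ideal.Quotient.mk_surjective x
        rw [Ideal.quotientMap_mk, Ideal.quotientMap_mk]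
        exact Ideal.Quotient.eq.mpr (h₁ y),
      Function.RightInverse.surjective (g := Ideal.quotientMap I Ψ hΨ) fun x => by
        obtain ⟨y, rfl⟩ := Ideal.Quotient.mk_surjective x
        rw [Ideal.quotientMap_mk, Ideal.quotientMap_mk]
        exact Ideal.Quotient.eq.mpr (h₂ y)⟩

/-- `Φ̄` on a class (bookkeeping). [cite: Lang2002, Ch. II §1] -/
@[simp] theorem truncEquiv_mk (I : Ideal S) (Φ Ψ : S →+* S) (hΦ : I ≤ I.comap Φ) (hΨ : I ≤ I.comap Ψ)
    (h₁ : ∀ y, Ψ (Φ y) - y ∈ I) (h₂ : ∀ y, Φ (Ψ y) - y ∈ I) (y : S) :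
    truncEquiv I Φ Ψ hΦ hΨ h₁ h₂ (Ideal.Quotient.mk I y) = Ideal.Quotient.mk I (Φ y) :=
  Ideal.quotientMap_mk (I := I) (J := I) (f := Φ) (H := hΦ) (x := y)

/-- `Φ r = r`, `Φ ≡ id (mod r^a)` ⇒ `Φ̄ ∈ level r̄ a` (bookkeeping; "`Ψ̄_𝔇(σ̄) ∈ 𝔄̄_1`"). [cite: Lang2002, Ch. II §1] -/
theorem truncEquiv_mem_level {I : Ideal S} {Φ Ψ : S →+* S} {hΦ : I ≤ I.comap Φ} {hΨ : I ≤ I.comap Ψ}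
    {h₁ : ∀ y, Ψ (Φ y) - y ∈ I} {h₂ : ∀ y, Φ (Ψ y) - y ∈ I} {r : S} {a : ℕ} (hr : Φ r = r) (hc : IsCong r a Φ) :
    truncEquiv I Φ Ψ hΦ hΨ h₁ h₂ ∈ level (Ideal.Quotient.mk I r) a := by
  refine ⟨by rw [truncEquiv_mk, hr], fun x => ?_⟩
  obtain ⟨y, rfl⟩ := Ideal.Quotient.mk_surjective x
  obtain ⟨z, hz⟩ := hc y
  exact ⟨Ideal.Quotient.mk I z, by rw [truncEquiv_mk, hz, map_add, map_mul, map_pow]⟩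

/-- `red A = Φ̄ ↔ A ≡ Φ (mod I)` pointwise (bookkeeping; T107 `r = 1`: "`X′ ≡ Ψ_𝔇(σ) mod σ^p`" becomes `red X′ = Ψ̄_𝔇(σ̄)` in `𝔄̄`).
[cite: Lang2002, Ch. II §1] -/
theorem reduce_eq_truncEquiv_iff {I : Ideal S} {A : idealStab I} {Φ Ψ : S →+* S} {hΦ : I ≤ I.comap Φ} {hΨ : I ≤ I.comap Ψ}
    {h₁ : ∀ y, Ψ (Φ y) - y ∈ I} {h₂ : ∀ y, Φ (Ψ y) - y ∈ I} :
    reduce I A = truncEquiv I Φ Ψ hΦ hΨ h₁ h₂ ↔ ∀ y, (A : S ≃+* S) y - Φ y ∈ I := by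
  refine ⟨fun h y => Ideal.Quotient.eq.mp (by rw [← reduce_mk, ← truncEquiv_mk I Φ Ψ hΦ hΨ h₁ h₂, h]),
    fun h => RingEquiv.ext fun x => ?_⟩
  obtain ⟨y, rfl⟩ := Ideal.Quotient.mk_surjective x
  rw [reduce_mk, truncEquiv_mk]
  exact Ideal.Quotient.eq.mpr (h y)

end Literature.AlgebraicGeometry.Resolution.WeightedBlowup.OrderFiltration
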